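import Literature.Computability.Cryptography.LiuPassLemma53Density
import Literature.Computability.Cryptography.LiuPassLemma53HidingMain
import Literature.Computability.Cryptography.LiuPassLemma53HidingProgram
import Literature.Computability.Cryptography.GoldreichLevinHidingLen
import Literature.Computability.Cryptography.LiuPassCondGenProgram
import Literature.Computability.Cryptography.LiuPassHeurProgram
import Literature.Computability.Cryptography.YaoInvProgram
import Literature.Computability.Cryptography.IndistinguishabilityProofs
import Literature.Computability.Complexity.CountingHierarchyProofs
import HarnessLib

/-!
# Liu–Pass Lemma 5.3 (saturated form) from the Goldreich–Levin theorem, and Thm 5.5 / Thm 1.1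

Assembly level of the decomposition of `condEPPRG_of_OWFExist` (Liu–Pass, FOCS 2020, Thm 5.5).
With the construction `L53Params` (`LiuPassLemma53Defs.lean`), its density
(`LiuPassLemma53Density.lean`) and the hiding claim (`LiuPassLemma53Hiding*.lean`) in hand, this
file proves

* `liuPass_lemma53_sat` — **Lemma 5.3 for saturated families `𝒮`** (every `S_n` a union of fibres of
  `f`; this is the case of the regular sets `lpRegSet f` of Lemma 5.4, `isSaturated_lpRegSet`, to
  which Thm 5.5 applies the lemma) — from the Goldreich–Levin theorem for hiding functions
  (`goldreichLevin_hiding_len`, the fixed-output-length form of the named fact `goldreichLevin_hiding`,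
  `GoldreichLevinHidingLen.lean`) alone: `liuPass_lemma53_sat_of_GL` (the efficiency clauses
  are `L53Params.F_mem_FP`, `L53Params.Hc_mem_FP` of `LiuPassLemma53Programs.lean`, and the
  inverter of the hiding claim is polynomial time by `L53Params.hidRun_polyTime_holds`);
* `condEPPRG_of_OWFExist_of_lemma53_sat` — Thm 5.5 from the saturated Lemma 5.3 (the assembly of
  `LiuPassCondFromRegular.lean`, verbatim, noting that `lpRegSet f` is saturated);
* `OWFExist_iff_isMildlyHardOnAverage_liuPassKt_of_GL` — Thm 1.1 (the tree's S02) from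
  `goldreichLevin_hiding_len`, everything else proved in the tree.

Pseudorandomness clause, as printed (arXiv:2009.11514, Appendix): on the seeds of Lemma 5.3,
`f'_{r(n)} ‖ GL` *is* the real Goldreich–Levin sample for the hiding function `g = f_{r(n)}`
(`F_append_Hc_eq_glReal`), which is `𝒮`-hiding (`isHidingOver_g`); by `goldreichLevin_hiding_len` it is
indistinguishable from the ideal sample `g(x‖ρ) ‖ σ ‖ u`, which is `3/n^{α'/2}`-close to uniform
(`eventually_density_ideal`); a negligible advantage is eventually `≤ 1/n^{α'/2}`, whence `4/n^{α'/2}`.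
`g` has an output length depending on the level only (`hasSeedLength_g`), as the GL fact requires.

## References

* Y. Liu, R. Pass, *On one-way functions and Kolmogorov complexity*, FOCS 2020
  (arXiv:2009.11514), Lemma 5.3, Thm 5.5, Thm 1.1 and Appendix.
* O. Goldreich, L. Levin, *A hard-core predicate for all one-way functions*, STOC 1989.
-/

namespace Literature.Computability.Cryptography

open Finset Filter Asymptotics _root_.Computability Complexity AffineStr

/-! ### Saturation of the regular sets of Lemma 5.4 -/

/-- **The regular sets `lpRegSet f` are saturated**: membership of `x` depends only on the size of
the fibre of `f x`. [Y. Liu, R. Pass, FOCS 2020, proof of Lemma 5.4] [folklore] -/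
theorem isSaturated_lpRegSet (f : List Bool → List Bool) : IsSaturated f (lpRegSet f) := by
  classical
  intro n x x' hx hfx
  have hpc : preimCard f n x'.toList = preimCard f n x.toList := by
    unfold preimCard
    congr 1
    exact Finset.filter_congr fun z _ => by rw [hfx]
  have hb := preimCard_of_mem_lpRegSet hx
  rw [← hpc] at hb
  simpa [lpRegSet, regCls] using hb

/-! ### Push-forwards of `condUniform` depend only on the map on the set -/

/-- `(condUniform T).map φ = (condUniform T).map ψ` when `φ = ψ` on the nonempty `T`. [folklore] -/
theorem condUniform_map_congr {T : Finset (List Bool)} (hT : T.Nonempty) {φ ψ : List Bool → List Bool}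
    (h : ∀ w ∈ T, φ w = ψ w) : (condUniform T).map φ = (condUniform T).map ψ := by
  classical
  rw [condUniform_eq hT]
  ext b
  simp only [PMF.map_apply, PMF.uniformOfFinset_apply]
  refine tsum_congr fun a => ?_
  by_cases ha : a ∈ T
  · rw [h a ha]
  · simp [ha]

/-- Triangle inequality for the distinguishing advantage. [Goldreich 2001, §3.2.2] [folklore] -/
theorem distAdvantage_triangle (D : RandAlg (List Bool) Bool) (X Y Z : Ensemble (List Bool)) (n : ℕ) :
    distAdvantage D X Z n ≤ distAdvantage D X Y n + distAdvantage D Y Z n := by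
  unfold distAdvantage; exact abs_sub_le _ _ _

/-- The distinguishing advantage at `n` depends only on the `n`-th distributions. [folklore] -/
theorem distAdvantage_congr_left (D : RandAlg (List Bool) Bool) {X X' : Ensemble (List Bool)} (Y : Ensemble (List Bool)) {n : ℕ}
    (h : X n = X' n) : distAdvantage D X Y n = distAdvantage D X' Y n := by
  unfold distAdvantage; rw [h]

/-- `1/n^{α'} ≤ 1/n^{α'/2}` for `n ≥ 1` (natural vs. real exponent). [folklore] -/
theorem one_div_pow_le_one_div_rpow_half {n α' : ℕ} (hn : 1 ≤ n) :
    1 / (n : ℝ) ^ α' ≤ 1 / (n : ℝ) ^ ((α' : ℝ) / 2) := by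
  have hn1 : (1 : ℝ) ≤ n := by exact_mod_cast hn
  have hpow : (n : ℝ) ^ ((α' : ℝ) / 2) ≤ (n : ℝ) ^ α' := by
    rw [← Real.rpow_natCast]
    exact Real.rpow_le_rpow_of_exponent_le hn1 (by linarith [Nat.cast_nonneg (α := ℝ) α'])
  exact one_div_le_one_div_of_le (Real.rpow_pos_of_pos (by positivity) _) hpow

namespace L53Params

variable (Q : L53Params)

/-! ### The pseudorandomness clause -/

/-- **`g = f_{r(·)}` has an output length depending only on the level**: on `x ‖ ρ` with
`|x| = n`, `|ρ| = m(n)`, `|g r (x ‖ ρ)| = (n + m(n) − N) + L(N)` with `N = nOfG (n + m(n))`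
(`= m(n) + L(n)` once `N = n`, i.e. for `n ≥ γ'`). [folklore] -/
theorem hasSeedLength_g (r : ℕ → ℕ) :
    HasSeedLength (Q.g r) (fun _ => Finset.univ) Q.m fun n => (n + Q.m n - Q.nOfG (n + Q.m n)) + Q.L (Q.nOfG (n + Q.m n)) := by
  intro n x ρ _ hρ
  have hlen : (x.toList ++ ρ).length = n + Q.m n := by rw [List.length_append, List.Vector.toList_length, hρ]
  simp only [L53Params.g, hlen, Q.length_gcore, List.length_drop]


/-- On the seeds of Lemma 5.3, `f'_{r(n)} ‖ GL` is distributed as the real Goldreich–Levin sample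
for `g = f_{r(n)}` (`n ≥ γ'`, `S_n ≠ ∅`). [Y. Liu, R. Pass, FOCS 2020, Appendix] [folklore] -/
theorem map_F_append_Hc_eq_glRealEns (S : ∀ n : ℕ, Finset (List.Vector Bool n)) (r : ℕ → ℕ) {n : ℕ} (hn : Q.γ' ≤ n)
    (hS : (S n).Nonempty) :
    ((condUniform (lpSeeds S Q.c n)).map fun w => Q.F (r n) w ++ Q.Hc w) = glRealEns (Q.g r) S Q.m Q.γ' n := by
  have hT : (lpSeeds S Q.c n).Nonempty := by
    rw [Q.lpSeeds_eq_blockSeeds S hn]; exact blockSeeds_nonempty_iff.2 hS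
  rw [condUniform_map_congr hT (fun w hw => Q.F_append_Hc_eq_glReal r hn (Q.length_of_mem_lpSeeds' hw)),
    Q.lpSeeds_eq_blockSeeds S hn]
  rfl

/-- **Pseudorandomness (Liu–Pass Lemma 5.3, second clause) for saturated `𝒮`, from the
Goldreich–Levin theorem**: `f'_{r(n)}(seed) ‖ GL(seed)` is `4/n^{α'/2}`-indistinguishable from
`U_{ℓ'(n)}`, in the exact form of `liuPass_lemma53`. [Y. Liu, R. Pass, FOCS 2020, Lemma 5.3 and
Appendix (proof: "`REAL ≈_c HYB₂ ≈_s U`")] [cite: LiuPassFOCS2020, Lemma 5.3 (proof, Appendix)] -/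
theorem eventually_pseudorandom {S : ∀ n : ℕ, Finset (List.Vector Bool n)} {r : ℕ → ℕ}
    (hGL : goldreichLevin_hiding_len) (hSOWF : IsSOWF Q.f S) (hreg : IsRegularOver Q.f S r) (hsat : IsSaturated Q.f S)
    (hP : ∀ x : List Bool, (Q.f x).length ≤ Q.P.eval x.length) (hdense : ∀ n, 1 ≤ n → 2 ^ n ≤ n * (S n).card)
    (D : RandAlg (List Bool) Bool) (hD : IsPPT D encodeBool) :
    ∀ᶠ n in atTop, distAdvantage D (fun n => (condUniform (lpSeeds S Q.c n)).map fun w => Q.F (r n) w ++ Q.Hc w)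
        (uniformEnsemble fun n => lpLen53 Q.c Q.α' n + Q.γ' * Nat.log 2 n) n ≤ 4 / (n : ℝ) ^ ((Q.α' : ℝ) / 2) := by
  have hne : ∀ᶠ n in atTop, (S n).Nonempty := (eventually_ge_atTop 1).mono fun n hn => nonempty_of_dense (hdense n hn)
  have hhid : IsHidingOver (Q.g r) S Q.m := Q.isHidingOver_g hSOWF hreg hsat hP hidRun_polyTime_holds
  have hind := hGL S (Q.g r) Q.m Q.γ' _ (fun n x ρ' _ hρ' => Q.hasSeedLength_g r n x ρ' (Finset.mem_univ _) hρ') hne hhid D hD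
  have hev1 : ∀ᶠ n : ℕ in atTop, distAdvantage D (glRealEns (Q.g r) S Q.m Q.γ') (glIdealEns (Q.g r) S Q.m Q.γ') n <
      1 / (n : ℝ) ^ Q.α' :=
    (isNegligible_iff_eventually_lt_of_nonneg (fun n => distAdvantage_nonneg _ _ _ n)).1 hind Q.α'
  have hev2 := Q.eventually_density_ideal S r hP (fun n x hx => (hreg n x hx).2) hdense
  filter_upwards [hev1, hev2, eventually_ge_atTop (max Q.γ' 1)] with n h1 h2 hn
  have hγ : Q.γ' ≤ n := le_trans (le_max_left _ _) hn
  have hn1 : 1 ≤ n := le_trans (le_max_right _ _) hn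
  have hSn : (S n).Nonempty := nonempty_of_dense (hdense n hn1)
  rw [distAdvantage_congr_left D (uniformEnsemble fun n => lpLen53 Q.c Q.α' n + Q.γ' * Nat.log 2 n)
    (Q.map_F_append_Hc_eq_glRealEns S r hγ hSn)]
  refine (distAdvantage_triangle D _ (glIdealEns (Q.g r) S Q.m Q.γ') _ n).trans ?_
  have hA : distAdvantage D (glIdealEns (Q.g r) S Q.m Q.γ') (uniformEnsemble fun n => lpLen53 Q.c Q.α' n + Q.γ' * Nat.log 2 n) n ≤
      3 / (n : ℝ) ^ ((Q.α' : ℝ) / 2) :=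
    (distAdvantage_le_tvDist_holds D _ _ n).trans h2
  have hB : distAdvantage D (glRealEns (Q.g r) S Q.m Q.γ') (glIdealEns (Q.g r) S Q.m Q.γ') n ≤ 1 / (n : ℝ) ^ ((Q.α' : ℝ) / 2) :=
    h1.le.trans (one_div_pow_le_one_div_rpow_half hn1)
  calc _ ≤ 1 / (n : ℝ) ^ ((Q.α' : ℝ) / 2) + 3 / (n : ℝ) ^ ((Q.α' : ℝ) / 2) := add_le_add hB hA
    _ = 4 / (n : ℝ) ^ ((Q.α' : ℝ) / 2) := by ring

/-- **All five clauses of Lemma 5.3 for the construction `Q`** (given the Goldreich–Levin theorem).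
[Y. Liu, R. Pass, FOCS 2020, Lemma 5.3] [folklore] -/
theorem lemma53_clauses {S : ∀ n : ℕ, Finset (List.Vector Bool n)} {r : ℕ → ℕ}
    (hGL : goldreichLevin_hiding_len) (hSOWF : IsSOWF Q.f S) (hreg : IsRegularOver Q.f S r) (hsat : IsSaturated Q.f S)
    (hP : ∀ x : List Bool, (Q.f x).length ≤ Q.P.eval x.length) (hdense : ∀ n, 1 ≤ n → 2 ^ n ≤ n * (S n).card) :
    ∃ (F : ℕ → List Bool → List Bool) (Hc : List Bool → List Bool),
      PolyTimeComputable id id (fun z => F (boolUnpair z).1.length (boolUnpair z).2) ∧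
      PolyTimeComputable id id Hc ∧
      (∀ᶠ n in atTop, ∀ w ∈ lpSeeds S Q.c n, (F (r n) w).length = lpLen53 Q.c Q.α' n ∧ (Hc w).length = Q.γ' * Nat.log 2 n) ∧
      (∀ᶠ n in atTop, ((condUniform (lpSeeds S Q.c n)).map (F (r n))).tvDist (uniformBits (lpLen53 Q.c Q.α' n))
          ≤ 3 / (n : ℝ) ^ ((Q.α' : ℝ) / 2)) ∧
      (∀ D : RandAlg (List Bool) Bool, IsPPT D encodeBool → ∀ᶠ n in atTop,
        distAdvantage D (fun n => (condUniform (lpSeeds S Q.c n)).map fun w => F (r n) w ++ Hc w)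
          (uniformEnsemble fun n => lpLen53 Q.c Q.α' n + Q.γ' * Nat.log 2 n) n ≤ 4 / (n : ℝ) ^ ((Q.α' : ℝ) / 2)) :=
  ⟨Q.F, Q.Hc, Q.F_mem_FP hSOWF.1, Q.Hc_mem_FP, Q.eventually_lengths S r,
    Q.eventually_density S r hP (fun n x hx => (hreg n x hx).2) hdense,
    fun D hD => Q.eventually_pseudorandom hGL hSOWF hreg hsat hP hdense D hD⟩

end L53Params

/-! ### Lemma 5.3, saturated form -/

/-- **Liu–Pass 2020, Lemma 5.3, for saturated families** — the statement of the named fact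
`liuPass_lemma53` (`LiuPassCondFromRegular.lean`, q.v. for the rendering) with the extra hypothesis
that every `S_n` is a union of fibres of `f` (`IsSaturated f S`). Print has `f : S_n → {0,1}^*`, so
its fibres — and the regain factor `2^{r(n)-1}` in the hiding claim of the proof — live inside
`S_n`; with the tree's `IsRegularOver` (fibres counted in `{0,1}ⁿ`) that step needs saturation, which
holds for the regular sets `lpRegSet f` of Lemma 5.4 where Thm 5.5 applies the lemma
(`isSaturated_lpRegSet`). Proved below from `goldreichLevin_hiding_len` (`liuPass_lemma53_sat_of_GL`). [Y. Liu, R. Pass, FOCS 2020, Lemma 5.3 and Appendix (proof)]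
[cite: LiuPassFOCS2020, Lemma 5.3] -/
def liuPass_lemma53_sat : Prop :=
  ∀ (f : List Bool → List Bool) (S : ∀ n : ℕ, Finset (List.Vector Bool n)) (r : ℕ → ℕ),
    IsSOWF f S → IsRegularOver f S r → IsSaturated f S → (∀ n, 1 ≤ n → 2 ^ n ≤ n * (S n).card) →
    ∃ c : ℕ, 1 ≤ c ∧ ∀ α' γ' : ℕ, ∃ (F : ℕ → List Bool → List Bool) (Hc : List Bool → List Bool),
      PolyTimeComputable id id (fun z => F (boolUnpair z).1.length (boolUnpair z).2) ∧
      PolyTimeComputable id id Hc ∧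
      (∀ᶠ n in atTop, ∀ w ∈ lpSeeds S c n, (F (r n) w).length = lpLen53 c α' n ∧ (Hc w).length = γ' * Nat.log 2 n) ∧
      (∀ᶠ n in atTop, ((condUniform (lpSeeds S c n)).map (F (r n))).tvDist (uniformBits (lpLen53 c α' n))
          ≤ 3 / (n : ℝ) ^ ((α' : ℝ) / 2)) ∧
      (∀ D : RandAlg (List Bool) Bool, IsPPT D encodeBool → ∀ᶠ n in atTop,
        distAdvantage D (fun n => (condUniform (lpSeeds S c n)).map fun w => F (r n) w ++ Hc w)
          (uniformEnsemble fun n => lpLen53 c α' n + γ' * Nat.log 2 n) n ≤ 4 / (n : ℝ) ^ ((α' : ℝ) / 2))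

/-- **Lemma 5.3 (saturated form) from the Goldreich–Levin theorem.** The constant is
`c = deg P + 3` for a polynomial bound `P` on `|f x|` (from `f ∈ FP`).
[Y. Liu, R. Pass, FOCS 2020, Lemma 5.3 and Appendix (proof)] [cite: LiuPassFOCS2020, Lemma 5.3 (proof, Appendix)] -/
theorem liuPass_lemma53_sat_of_GL (hGL : goldreichLevin_hiding_len) : liuPass_lemma53_sat := by
  intro f S r hSOWF hreg hsat hdense
  obtain ⟨P, hP⟩ := exists_poly_length_le_of_mem_FP hSOWF.1
  refine ⟨P.natDegree + 3, by omega, fun α' γ' => ?_⟩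
  exact L53Params.lemma53_clauses ⟨f, P, α', γ'⟩ hGL hSOWF hreg hsat hP hdense

/-! ### Thm 5.5 and Thm 1.1 from the Goldreich–Levin theorem -/

/-- **Liu–Pass Thm 5.5 from the saturated Lemma 5.3**: OWFs give, for all `γ, δ > 1`, a
`1/n^δ`-cond EP-PRG of stretch `γ⌊log₂ n⌋` (`condEPPRG_of_OWFExist`). The assembly of
`condEPPRG_of_OWFExist_of_lemma53` (`LiuPassCondFromRegular.lean`) verbatim — Lemma 5.4's regular
sets `lpRegSet f` are saturated (`isSaturated_lpRegSet`) — with the two efficiency facts of that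
file now proved (`condGen_polyTime_holds`, `condRedRun_polyTime_holds`).
[Y. Liu, R. Pass, FOCS 2020, Thm 5.5] [cite: LiuPassFOCS2020, Thm 5.5] -/
theorem condEPPRG_of_OWFExist_of_lemma53_sat (h53 : liuPass_lemma53_sat) : condEPPRG_of_OWFExist := by
  intro hOWF γ δ hγ hδ
  obtain ⟨f, hf⟩ := hOWF
  have hS : IsSOWF f (lpRegSet f) := isSOWF_lpRegSet hf
  have hreg : IsRegularOver f (lpRegSet f) (lpRegIdx f) := fun n x hx => preimCard_of_mem_lpRegSet hx
  have hdense : ∀ n, 1 ≤ n → 2 ^ n ≤ n * (lpRegSet f n).card := fun n hn => card_lpRegSet f hn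
  obtain ⟨c, hc, hfam⟩ := h53 f (lpRegSet f) (lpRegIdx f) hS hreg (isSaturated_lpRegSet f) hdense
  obtain ⟨F, Hc, hFpoly, hHpoly, hlen, hdens, hpr⟩ := hfam (2 * (2 * c + c * δ + 1)) (2 * (2 * (2 * c + c * δ + 1)) + 8 * (c + 1) * (γ + 1))
  let Q : CondParams := ⟨c, γ, δ, lpRegIdx f, F, Hc⟩
  have H : Q.Hyps (lpRegSet f) := ⟨hc, lpRegIdx_le f, hdense, hlen, hdens⟩
  refine ⟨Q.G, Q.E (lpRegSet f), Q.γ' + 2, condGen_polyTime_holds Q hc hFpoly hHpoly, fun N => Q.E_spec (lpRegSet f) N,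
    Q.length_G hc, ?_, ?_⟩
  · intro D hD
    exact CondParams.pseudorandom_G H hδ.le hpr
      (fun D' qD cl hD' _ hcl => Q.isPPT_red_of condRedRun_polyTime_holds D' qD cl hD' hcl) D hD
  · exact CondParams.entropy_G H

/-- **Thm 5.5 from the Goldreich–Levin theorem.** [Y. Liu, R. Pass, FOCS 2020, Thm 5.5]
[cite: LiuPassFOCS2020, Thm 5.5] -/
theorem condEPPRG_of_OWFExist_of_GL (hGL : goldreichLevin_hiding_len) : condEPPRG_of_OWFExist :=
  condEPPRG_of_OWFExist_of_lemma53_sat (liuPass_lemma53_sat_of_GL hGL)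

/-- **Liu–Pass Thm 1.1 (the tree's S02) from the Goldreich–Levin theorem**: `OWF exist ↔ K^t is
mildly hard on average`, for every `t(n) ≥ (1+ε)n`. Yao's amplification, Thms 4.1, 5.2, 5.5 (modulo
`goldreichLevin_hiding_len`), 5.6 and all efficiency claims are proved in the tree.
[Y. Liu, R. Pass, FOCS 2020, Thm 1.1] [cite: LiuPassFOCS2020, Thm 1.1] -/
theorem OWFExist_iff_isMildlyHardOnAverage_liuPassKt_of_GL (hGL : goldreichLevin_hiding_len) :
    OWFExist_iff_isMildlyHardOnAverage_liuPassKt :=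
  OWFExist_iff_isMildlyHardOnAverage_liuPassKt_of_Yao_h55 weakOWFExist_iff_OWFExist_holds (condEPPRG_of_OWFExist_of_GL hGL)

end Literature.Computability.Cryptography
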